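import Literature.Computability.AlgebraicComplexity.BurgisserTransfer
import Literature.Computability.AlgebraicComplexity.PochhammerWilkinsonDefinable
import Literature.Computability.Complexity.CountingHierarchyInter
import HarnessLib

/-!
# Bürgisser's Theorem 4.1(2) from Lemma 2.12, Lemma 2.5(2), Thm. 2.10 and the Koiran step (proofs)

Sibling proof file of `BurgisserTransfer.lean` (D-0014). We PROVE the assembly of Bürgisser,
ECCC TR06-113, proof of Thm. 4.1(2) (p. 14–15), in the uniform form consumed by the tree's
conditional proof of his main theorem (`TauConjectureProofs.lean`):

* `Burgisser2009_thm41_2_uniform_of_steps` —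
  `PP_subset_PPoly_of_isPBounded_perPoly` (Lemma 2.12) `→ CH_subset_PPoly_of_PP_subset_PPoly`
  (Lemma 2.5(2)) `→ Burgisser2009_thm210` (Thm. 2.10) `→ Burgisser2009_thm41_koiranStep` (the
  application of Thm. 2.11) `→ Burgisser2009_thm41_2_uniform`;
* `not_isPBounded_constantFreeComplexity_perPoly_of_tauConjecture_of_steps` /`_of_facts` — with
  Cor. 3.9 (coefficient form, resp. as printed via `PochhammerWilkinsonDefinable.lean`) this gives
  Thm. 1.1(2), the tree's fact `not_isPBounded_constantFreeComplexity_perPoly_of_tauConjecture`,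
  from five cited theorems.

The printed proof treats the coefficients `b(n, k)` as nonnegative ("let
`b(n,k) = ∑_j b(n,k,j) 2^j` be the binary representation"); we fill this gap by splitting
`b = b⁺ - b⁻` and running the argument for both parts: the bit arrays of `b^{±}` are read off the
sign language `Sgn(b)` and the bit language `Bit(|b|)` of Def. 3.1, both in `CH`, through the
closure of `CH` under intersection (`CountingHierarchyInter.lean`) and first projections; under
`τ(Per) = n^{O(1)}` they are in `P/poly` (Lemma 2.12 + Lemma 2.5(2)). The Koiran step gives
`VNP⁰` families `G^{±}` with `B^{±}_n = G^{±}_{ℓ,λ}(Y, Z, bits)`, Thm. 2.10 gives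
`τ(2^{s(r)} G_r) = r^{O(1)}`, and the substitutions `Y_i ↦ 2^{2^{i-1}}`, `Z_i ↦ X^{2^{i-1}}`
(`ConstantFreeCircuits.lean`: `τ(f(g)) ≤ τ(f) + ∑ τ(g_i)`, repeated squaring) cost `O(ℓ² + λ²)`;
finally `2^{e(n)} f_n = 2^{s⁻}(2^{s⁺} f⁺_n) - 2^{s⁺}(2^{s⁻} f⁻_n)` with `e = s⁺ + s⁻` and all
bounds are polynomial in `ℓ + λ = O(log n)`, i.e. `(log n)^{O(1)}` (bookkeeping lemmas
`polylog_*`). No new definitions.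

## References

* P. Bürgisser, *On defining integers and proving arithmetic circuit lower bounds*, Comput.
  Complexity 18 (2009) 81–103 = ECCC TR06-113, Lemma 2.5, Thm. 2.10, Thm. 2.11, Lemma 2.12,
  Def. 3.1, Thm. 4.1(2) and its proof (p. 14–15).
* P. Koiran, *Valiant's model and the cost of computing integers*, Comput. Complexity 13 (2004)
  131–146, Thm. 4.3, Thm. 6.1, Cor. 6.5.
-/

noncomputable section

open MvPolynomial Computability Literature.Computability.Complexity

namespace Literature.Computability.AlgebraicComplexity

/-! ### Polylogarithmic bookkeeping: bounds of the form `(log₂ n + 2)^c` -/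

section Polylog

/-- `2 ≤ log₂ n + 2`. [folklore] -/
theorem two_le_log_add_two (n : ℕ) : 2 ≤ Nat.log 2 n + 2 := Nat.le_add_left 2 _

/-- A constant is polylog-bounded: `K ≤ (log₂ n + 2)^K`. [folklore] -/
theorem polylog_const (K : ℕ) : ∃ c : ℕ, ∀ n, K ≤ (Nat.log 2 n + 2) ^ c :=
  ⟨K, fun n => (Nat.lt_pow_self (by have := two_le_log_add_two n; omega)).le⟩

/-- Polylog bounds are closed under pointwise domination. [folklore] -/
theorem polylog_mono {f g : ℕ → ℕ} (hfg : ∀ n, g n ≤ f n) (hf : ∃ c : ℕ, ∀ n, f n ≤ (Nat.log 2 n + 2) ^ c) :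
    ∃ c : ℕ, ∀ n, g n ≤ (Nat.log 2 n + 2) ^ c := by
  obtain ⟨c, hc⟩ := hf
  exact ⟨c, fun n => (hfg n).trans (hc n)⟩

/-- Polylog bounds are closed under sums. [folklore] -/
theorem polylog_add {f g : ℕ → ℕ} (hf : ∃ c : ℕ, ∀ n, f n ≤ (Nat.log 2 n + 2) ^ c)
    (hg : ∃ c : ℕ, ∀ n, g n ≤ (Nat.log 2 n + 2) ^ c) :
    ∃ c : ℕ, ∀ n, f n + g n ≤ (Nat.log 2 n + 2) ^ c := by
  obtain ⟨a, ha⟩ := hf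
  obtain ⟨b, hb⟩ := hg
  refine ⟨a + b + 1, fun n => ?_⟩
  have hM : 2 ≤ Nat.log 2 n + 2 := two_le_log_add_two n
  have h1 : (Nat.log 2 n + 2) ^ a ≤ (Nat.log 2 n + 2) ^ (a + b) := Nat.pow_le_pow_right (by omega) (by omega)
  have h2 : (Nat.log 2 n + 2) ^ b ≤ (Nat.log 2 n + 2) ^ (a + b) := Nat.pow_le_pow_right (by omega) (by omega)
  calc f n + g n ≤ (Nat.log 2 n + 2) ^ (a + b) + (Nat.log 2 n + 2) ^ (a + b) :=
        Nat.add_le_add ((ha n).trans h1) ((hb n).trans h2)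
    _ = 2 * (Nat.log 2 n + 2) ^ (a + b) := by ring
    _ ≤ (Nat.log 2 n + 2) * (Nat.log 2 n + 2) ^ (a + b) := Nat.mul_le_mul_right _ hM
    _ = (Nat.log 2 n + 2) ^ (a + b + 1) := by ring

/-- Polylog bounds are closed under products. [folklore] -/
theorem polylog_mul {f g : ℕ → ℕ} (hf : ∃ c : ℕ, ∀ n, f n ≤ (Nat.log 2 n + 2) ^ c)
    (hg : ∃ c : ℕ, ∀ n, g n ≤ (Nat.log 2 n + 2) ^ c) :
    ∃ c : ℕ, ∀ n, f n * g n ≤ (Nat.log 2 n + 2) ^ c := by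
  obtain ⟨a, ha⟩ := hf
  obtain ⟨b, hb⟩ := hg
  refine ⟨a + b, fun n => ?_⟩
  rw [pow_add]
  exact Nat.mul_le_mul (ha n) (hb n)

/-- Polylog bounds are closed under fixed powers. [folklore] -/
theorem polylog_pow {f : ℕ → ℕ} (hf : ∃ c : ℕ, ∀ n, f n ≤ (Nat.log 2 n + 2) ^ c) (k : ℕ) :
    ∃ c : ℕ, ∀ n, f n ^ k ≤ (Nat.log 2 n + 2) ^ c := by
  obtain ⟨a, ha⟩ := hf
  refine ⟨a * k, fun n => ?_⟩
  rw [pow_mul]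
  exact Nat.pow_le_pow_left (ha n) k

/-- A p-bounded function of a polylog-bounded quantity is polylog-bounded. [folklore] -/
theorem polylog_comp {s f : ℕ → ℕ} (hs : IsPBounded s) (hf : ∃ c : ℕ, ∀ n, f n ≤ (Nat.log 2 n + 2) ^ c) :
    ∃ c : ℕ, ∀ n, s (f n) ≤ (Nat.log 2 n + 2) ^ c := by
  obtain ⟨a, ha⟩ := hs
  have h1 : ∃ c : ℕ, ∀ n, f n ^ a + a ≤ (Nat.log 2 n + 2) ^ c :=
    polylog_add (polylog_pow hf a) (polylog_const a)
  exact polylog_mono (fun n => ha (f n)) h1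

/-- `n + 2 ≤ 2 ^ (log₂ n + 2)`. [folklore] -/
theorem add_two_le_two_pow_log (n : ℕ) : n + 2 ≤ 2 ^ (Nat.log 2 n + 2) := by
  have h := Nat.lt_pow_succ_log_self one_lt_two n
  have h2 : 2 ≤ 2 ^ (Nat.log 2 n + 1) := by
    calc (2 : ℕ) = 2 ^ 1 := by norm_num
      _ ≤ 2 ^ (Nat.log 2 n + 1) := Nat.pow_le_pow_right (by norm_num) (by omega)
  calc n + 2 ≤ 2 ^ (Nat.log 2 n + 1) + 2 ^ (Nat.log 2 n + 1) := by omega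
    _ = 2 ^ (Nat.log 2 n + 2) := by ring

/-- `n ^ a + a ≤ (n + 2) ^ (a + 1)`. [folklore] -/
theorem pow_add_le_add_two_pow (n a : ℕ) : n ^ a + a ≤ (n + 2) ^ (a + 1) := by
  have h1 : n ^ a ≤ (n + 2) ^ a := Nat.pow_le_pow_left (by omega) a
  have h2 : a < (n + 2) ^ a := lt_of_lt_of_le (Nat.lt_pow_self (by norm_num : 1 < 2))
    (Nat.pow_le_pow_left (by omega) a)
  calc n ^ a + a ≤ (n + 2) ^ a + (n + 2) ^ a := by omega
    _ = (n + 2) ^ a * 2 := by ring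
    _ ≤ (n + 2) ^ a * (n + 2) := Nat.mul_le_mul_left _ (by omega)
    _ = (n + 2) ^ (a + 1) := by ring

/-- **A p-bounded quantity has polylog bit length**: `bitLen (p n) ≤ (a + 2) (log₂ n + 2)` for
`p n ≤ n^a + a`; in particular `n ↦ bitLen (p n)` is polylog-bounded (`ℓ(n), λ(n) = O(log n)`,
ECCC TR06-113, p. 14). [cite: Burgisser2006, proof of Thm. 4.1] -/
theorem polylog_bitLen {p : ℕ → ℕ} (hp : IsPBounded p) :
    ∃ c : ℕ, ∀ n, bitLen (p n) ≤ (Nat.log 2 n + 2) ^ c := by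
  obtain ⟨a, ha⟩ := hp
  have key : ∀ n, bitLen (p n) ≤ (a + 2) * (Nat.log 2 n + 2) := by
    intro n
    have h1 : p n ≤ 2 ^ ((Nat.log 2 n + 2) * (a + 1)) := by
      calc p n ≤ n ^ a + a := ha n
        _ ≤ (n + 2) ^ (a + 1) := pow_add_le_add_two_pow n a
        _ ≤ (2 ^ (Nat.log 2 n + 2)) ^ (a + 1) := Nat.pow_le_pow_left (add_two_le_two_pow_log n) _
        _ = 2 ^ ((Nat.log 2 n + 2) * (a + 1)) := by rw [← pow_mul]
    have h2 : Nat.log 2 (p n) ≤ (Nat.log 2 n + 2) * (a + 1) := by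
      calc Nat.log 2 (p n) ≤ Nat.log 2 (2 ^ ((Nat.log 2 n + 2) * (a + 1))) := Nat.log_mono_right h1
        _ = (Nat.log 2 n + 2) * (a + 1) := Nat.log_pow one_lt_two _
    unfold bitLen
    have h3 : 1 ≤ Nat.log 2 n + 2 := by omega
    nlinarith
  exact polylog_mono key (polylog_mul (polylog_const (a + 2)) ⟨1, fun n => by rw [pow_one]⟩)

/-- `Nat.pair a b ≤ (a + b + 1)²`. [folklore] -/
theorem pair_le_sq (a b : ℕ) : Nat.pair a b ≤ (a + b + 1) ^ 2 := by
  unfold Nat.pair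
  split_ifs <;> nlinarith

/-- From a polylog bound to the target form with finitely many exceptional small `n`: if
`g n ≤ (log₂ n + 2)^c` for `n ≥ 2`, then `g n ≤ (log₂ n + 2)^{c'}` for all `n`. [folklore] -/
theorem polylog_of_two_le {g : ℕ → ℕ} {c : ℕ} (h : ∀ n, 2 ≤ n → g n ≤ (Nat.log 2 n + 2) ^ c) :
    ∃ c' : ℕ, ∀ n, g n ≤ (Nat.log 2 n + 2) ^ c' := by
  refine ⟨c + g 0 + g 1, fun n => ?_⟩
  have hM : 2 ≤ Nat.log 2 n + 2 := two_le_log_add_two n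
  rcases Nat.lt_or_ge n 2 with hn | hn
  · have hlt : g n < 2 ^ (c + g 0 + g 1) := by
      have := Nat.lt_two_pow_self (n := g n)
      interval_cases n
      · exact lt_of_lt_of_le this (Nat.pow_le_pow_right (by norm_num) (by omega))
      · exact lt_of_lt_of_le this (Nat.pow_le_pow_right (by norm_num) (by omega))
    exact hlt.le.trans (Nat.pow_le_pow_left hM _)
  · exact (h n hn).trans (Nat.pow_le_pow_right (by omega) (by omega))

end Polylog

/-! ### `τ` is free on the substitution of p. 15 and cheap on iterated squares -/

/-- The constants `0, 1 ∈ ℤ` coming from bits are sign constants: `τ(C [bit]) = 0`. [folklore] -/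
theorem constantFreeComplexity_C_toNat {σ : Type*} (bit : Bool) :
    constantFreeComplexity (C ((bit.toNat : ℕ) : ℤ) : MvPolynomial σ ℤ) = 0 := by
  cases bit
  · simp [constantFreeComplexity_zero]
  · simp [constantFreeComplexity_one]

/-- Every entry of the substitution `blockSubst` (a variable or a bit constant) has `τ = 0`
(ECCC TR06-113, p. 15: the substitution costs only the `ℓ + λ` gates for the powers). [cite: Burgisser2006, proof of Thm. 4.1(2)] -/
theorem constantFreeComplexity_blockSubst (p q : ℕ → ℕ) (n : ℕ)
    (v : KoiranVars (bitLen (p n)) (bitLen (q n))) :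
    constantFreeComplexity (blockSubst p q n v) = 0 := by
  rcases v with v | v | v | v
  · simp [blockSubst]
  · simpa [blockSubst] using constantFreeComplexity_C_toNat (σ := Fin (bitLen (p n)) ⊕ Fin (bitLen (q n))) (n.testBit v)
  · simpa [blockSubst] using constantFreeComplexity_C_toNat (σ := Fin (bitLen (p n)) ⊕ Fin (bitLen (q n))) ((p n).testBit v)
  · simpa [blockSubst] using constantFreeComplexity_C_toNat (σ := Fin (bitLen (p n)) ⊕ Fin (bitLen (q n))) ((q n).testBit v)

/-- The cost of the powers `2^{2^0}, …, 2^{2^{ℓ-1}}` and `X^{2^0}, …, X^{2^{λ-1}}` substituted for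
`(Y, Z)` (each by repeated squaring) is at most `ℓ² + λ²`. [cite: Burgisser2006, proof of Thm. 4.1(2)] -/
theorem sum_constantFreeComplexity_powers_le (ℓ μ : ℕ) :
    ∑ v : Fin ℓ ⊕ Fin μ, constantFreeComplexity
        (Sum.elim (fun i : Fin ℓ => (C (2 : ℤ) : MvPolynomial (Fin 1) ℤ) ^ 2 ^ (i : ℕ))
          (fun i : Fin μ => (X 0 : MvPolynomial (Fin 1) ℤ) ^ 2 ^ (i : ℕ)) v) ≤ ℓ ^ 2 + μ ^ 2 := by
  rw [Fintype.sum_sum_type]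
  simp only [Sum.elim_inl, Sum.elim_inr]
  refine Nat.add_le_add ?_ ?_
  · calc ∑ i : Fin ℓ, constantFreeComplexity ((C (2 : ℤ) : MvPolynomial (Fin 1) ℤ) ^ 2 ^ (i : ℕ))
        ≤ ∑ _i : Fin ℓ, ℓ := Finset.sum_le_sum fun i _ => by
          rw [← C_pow]
          exact (constantFreeComplexity_C_two_pow_two_pow_le (σ := Fin 1) i).trans (by omega)
      _ = ℓ ^ 2 := by simp [sq]
  · calc ∑ i : Fin μ, constantFreeComplexity ((X 0 : MvPolynomial (Fin 1) ℤ) ^ 2 ^ (i : ℕ))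
        ≤ ∑ _i : Fin μ, μ := Finset.sum_le_sum fun i _ =>
          (constantFreeComplexity_X_pow_two_pow_le (σ := Fin 1) 0 i).trans i.is_lt.le
      _ = μ ^ 2 := by simp [sq]

/-! ### One sign: the bound for a 0/1 bit array decidable in `CH` -/

/-- **The core of the proof of Thm. 4.1(2), for one nonnegative part.** Under `τ(Per) = n^{O(1)}`,
Thm. 2.10, the Koiran step and `CH ⊆ P/poly`: for `p, q` p-bounded with `p(n) ≥ n` and a bit array
`bits(n, k, j)` read off a `CH` language `L` on `k ≤ q(n)` (`encBitQuery n k j true ∈ L ↔ bits`),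
there are a p-bounded `s` and `c` with
`τ(2^{s(r(n))} · ∑_{k ≤ q n} (∑_{j ≤ p n} bits(n,k,j) 2^j) X^k) ≤ (log₂ n + 2)^c` for all `n`, where
`r(n) = ⟨ℓ(n), λ(n)⟩` (ECCC TR06-113, proof of Thm. 4.1(2), p. 14–15). [cite: Burgisser2006, proof of Thm. 4.1(2)] -/
theorem thm41_2_signPart
    (hτ : IsPBounded fun n => constantFreeComplexity (perPoly (Fin n) ℤ))
    (h210 : Burgisser2009_thm210) (hK : Burgisser2009_thm41_koiranStep) (hCHP : CH ⊆ PPoly)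
    {p q : ℕ → ℕ} (hp : IsPBounded p) (hq : IsPBounded q) (hpn : ∀ n, n ≤ p n)
    (bits : ℕ → ℕ → ℕ → Bool) {L : Language Bool} (hL : L ∈ CH)
    (hagree : ∀ n k j, k ≤ q n → (encBitQuery n k j true ∈ L ↔ bits n k j = true)) :
    ∃ s : ℕ → ℕ, IsPBounded s ∧ ∃ c : ℕ, ∀ n,
      constantFreeComplexity
          (C ((2 : ℤ) ^ s (Nat.pair (bitLen (p n)) (bitLen (q n)))) *
            ∑ k ∈ Finset.range (q n + 1),
              (∑ j ∈ Finset.range (p n + 1),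
                if bits n k j then (C (2 : ℤ) : MvPolynomial (Fin 1) ℤ) ^ j else 0) * X 0 ^ k) ≤
        (Nat.log 2 n + 2) ^ c := by
  -- the Koiran step and Thm. 2.10
  obtain ⟨G, hGfam, hGid⟩ :=
    hK p q hp hq hpn bits ⟨L, hCHP hL, fun n k j hk _ => hagree n k j hk⟩
  obtain ⟨s, hs, d, hd⟩ := h210 hτ _ _ hGfam
  refine ⟨s, hs, ?_⟩
  -- the cost bound, pointwise
  have key : ∀ n,
      constantFreeComplexity
          (C ((2 : ℤ) ^ s (Nat.pair (bitLen (p n)) (bitLen (q n)))) *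
            ∑ k ∈ Finset.range (q n + 1),
              (∑ j ∈ Finset.range (p n + 1),
                if bits n k j then (C (2 : ℤ) : MvPolynomial (Fin 1) ℤ) ^ j else 0) * X 0 ^ k) ≤
        (Nat.pair (bitLen (p n)) (bitLen (q n)) ^ d + d) + (bitLen (p n) ^ 2 + bitLen (q n) ^ 2) := by
    intro n
    set ℓ := bitLen (p n) with hℓ
    set μ := bitLen (q n) with hμ
    -- Thm. 2.10 at the member `r = ⟨ℓ, μ⟩`
    have h1 : constantFreeComplexity (C ((2 : ℤ) ^ s (Nat.pair ℓ μ)) * G ℓ μ) ≤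
        Nat.pair ℓ μ ^ d + d := by
      have := hd (Nat.pair ℓ μ)
      dsimp only at this
      rw [Nat.unpair_pair] at this
      exact this
    set r := Nat.pair ℓ μ with hr
    -- the substitution of p. 15 is free
    have h2 : C ((2 : ℤ) ^ s r) * twoBlockPoly p q bits n =
        aeval (blockSubst p q n) (C ((2 : ℤ) ^ s r) * G ℓ μ) := by
      rw [map_mul, aeval_C, algebraMap_eq, hGid n]
    have h3 : constantFreeComplexity (C ((2 : ℤ) ^ s r) * twoBlockPoly p q bits n) ≤ r ^ d + d := by
      rw [h2]
      refine (constantFreeComplexity_aeval_le _ _).trans ?_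
      rw [Finset.sum_eq_zero fun v _ => constantFreeComplexity_blockSubst p q n v, add_zero]
      exact h1
    -- the powers
    set ψ : Fin ℓ ⊕ Fin μ → MvPolynomial (Fin 1) ℤ :=
      Sum.elim (fun i : Fin ℓ => (C (2 : ℤ) : MvPolynomial (Fin 1) ℤ) ^ 2 ^ (i : ℕ))
        (fun i : Fin μ => (X 0 : MvPolynomial (Fin 1) ℤ) ^ 2 ^ (i : ℕ)) with hψ
    have h4 : C ((2 : ℤ) ^ s r) *
        ∑ k ∈ Finset.range (q n + 1), (∑ j ∈ Finset.range (p n + 1),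
          if bits n k j then (C (2 : ℤ) : MvPolynomial (Fin 1) ℤ) ^ j else 0) * X 0 ^ k =
        aeval ψ (C ((2 : ℤ) ^ s r) * twoBlockPoly p q bits n) := by
      rw [map_mul, aeval_C, algebraMap_eq, hψ, aeval_twoBlockPoly_powers]
    rw [h4]
    refine (constantFreeComplexity_aeval_le _ _).trans ?_
    exact Nat.add_le_add h3 (sum_constantFreeComplexity_powers_le ℓ μ)
  -- everything is polylog
  have hr : ∃ c : ℕ, ∀ n, Nat.pair (bitLen (p n)) (bitLen (q n)) ≤ (Nat.log 2 n + 2) ^ c :=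
    polylog_mono (fun _ => pair_le_sq _ _)
      (polylog_pow (polylog_add (polylog_add (polylog_bitLen hp) (polylog_bitLen hq))
        (polylog_const 1)) 2)
  exact polylog_mono key
    (polylog_add (polylog_add (polylog_pow hr d) (polylog_const d))
      (polylog_add (polylog_pow (polylog_bitLen hp) 2) (polylog_pow (polylog_bitLen hq) 2)))

/-! ### Assembly: Thm. 4.1(2), uniform form -/

/-- `tauPoly` of the scaled truncated power series is `τ` of the corresponding element of
`MvPolynomial (Fin 1) ℤ` (through `uniqueAlgEquiv`). [cite: Burgisser2006, Def. 2.6] -/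
theorem tauPoly_C_mul_sum (e q : ℕ) (b : ℕ → ℤ) :
    tauPoly (Polynomial.C ((2 : ℤ) ^ e) *
        ∑ k ∈ Finset.range (q + 1), Polynomial.C (b k) * Polynomial.X ^ k) =
      constantFreeComplexity (C ((2 : ℤ) ^ e) *
        ∑ k ∈ Finset.range (q + 1), C (b k) * (X 0 : MvPolynomial (Fin 1) ℤ) ^ k) := by
  rw [tauPoly_def]
  congr 1
  rw [MvPolynomial.uniqueAlgEquiv_symm_apply, Polynomial.eval₂_mul, Polynomial.eval₂_C,
    Polynomial.eval₂_finsetSum]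
  congr 1
  refine Finset.sum_congr rfl fun k _ => ?_
  rw [Polynomial.eval₂_mul, Polynomial.eval₂_C, Polynomial.eval₂_X_pow, Fin.default_eq_zero]

/-- `τ(2^m) ≤ 3 (m + 1)` (binary powering, `log₂ m ≤ m`). [cite: Burgisser2009, §2.2] -/
theorem constantFreeComplexity_C_two_pow_le' {σ : Type*} (m : ℕ) :
    constantFreeComplexity (C ((2 : ℤ) ^ m) : MvPolynomial σ ℤ) ≤ 3 * (m + 1) :=
  (constantFreeComplexity_C_two_pow_le m).trans (Nat.mul_le_mul_left 3 (Nat.succ_le_succ (Nat.log_le_self 2 m)))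

/-- The bits of the nonnegative part: `∑_{j ≤ N} [0 ≤ a ∧ bit_j |a|] 2^j = a⁺` for `|a| < 2^{N+1}`,
with values in `MvPolynomial (Fin 1) ℤ`. [folklore] -/
theorem sum_bits_posPart {a : ℤ} {N : ℕ} (h : a.natAbs < 2 ^ (N + 1)) :
    (∑ j ∈ Finset.range (N + 1),
        if (decide (0 ≤ a) && a.natAbs.testBit j) then (C (2 : ℤ) : MvPolynomial (Fin 1) ℤ) ^ j else 0) =
      C (if 0 ≤ a then a else 0) := by
  by_cases h0 : 0 ≤ a
  · simp only [h0, decide_true, Bool.true_and, if_true]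
    rw [map_ofNat C 2, sum_ite_testBit_two_pow h, ← map_natCast C, Int.natCast_natAbs, abs_of_nonneg h0]
  · simp only [h0, decide_false, Bool.false_and, if_false]
    simp

/-- The bits of the negative part: `∑_{j ≤ N} [a < 0 ∧ bit_j |a|] 2^j = a⁻` for `|a| < 2^{N+1}`. [folklore] -/
theorem sum_bits_negPart {a : ℤ} {N : ℕ} (h : a.natAbs < 2 ^ (N + 1)) :
    (∑ j ∈ Finset.range (N + 1),
        if (decide (a < 0) && a.natAbs.testBit j) then (C (2 : ℤ) : MvPolynomial (Fin 1) ℤ) ^ j else 0) =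
      C (if a < 0 then -a else 0) := by
  by_cases h0 : a < 0
  · simp only [h0, decide_true, Bool.true_and, if_true]
    rw [map_ofNat C 2, sum_ite_testBit_two_pow h, ← map_natCast C, Int.natCast_natAbs, abs_of_neg h0]
  · simp only [h0, decide_false, Bool.false_and, if_false]
    simp

/-- The index function `r(n) = ⟨ℓ(n), λ(n)⟩` is p-bounded. [folklore] -/
theorem isPBounded_pair_bitLen {p q : ℕ → ℕ} (hp : IsPBounded p) (hq : IsPBounded q) :
    IsPBounded fun n => Nat.pair (bitLen (p n)) (bitLen (q n)) := by
  have h : IsPBounded fun n => (p n + 1 + (q n + 1) + 1) ^ 2 :=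
    IsPBounded.pow_holds (IsPBounded.add_holds (IsPBounded.add_holds
      (IsPBounded.add_holds hp (IsPBounded.const 1)) (IsPBounded.add_holds hq (IsPBounded.const 1)))
      (IsPBounded.const 1)) 2
  refine h.mono fun n => (pair_le_sq _ _).trans ?_
  exact Nat.pow_le_pow_left (by have := bitLen_le (p n); have := bitLen_le (q n); omega) 2

/-- The index function `r(n) = ⟨ℓ(n), λ(n)⟩` is polylog-bounded. [folklore] -/
theorem polylog_pair_bitLen {p q : ℕ → ℕ} (hp : IsPBounded p) (hq : IsPBounded q) :
    ∃ c : ℕ, ∀ n, Nat.pair (bitLen (p n)) (bitLen (q n)) ≤ (Nat.log 2 n + 2) ^ c :=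
  polylog_mono (fun _ => pair_le_sq _ _)
    (polylog_pow (polylog_add (polylog_add (polylog_bitLen hp) (polylog_bitLen hq))
      (polylog_const 1)) 2)

/-- **Bürgisser's Theorem 4.1(2) (uniform form) from Lemma 2.12, Lemma 2.5(2), Theorem 2.10 and the
application of Theorem 2.11** (ECCC TR06-113, proof of Thm. 4.1(2), p. 14–15; the sign of the
coefficients, not treated in the printed proof, is handled by `b = b⁺ - b⁻`). [cite: Burgisser2006, Thm. 4.1(2)] -/
theorem Burgisser2009_thm41_2_uniform_of_steps (h212 : PP_subset_PPoly_of_isPBounded_perPoly)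
    (h25 : CH_subset_PPoly_of_PP_subset_PPoly) (h210 : Burgisser2009_thm210)
    (hK : Burgisser2009_thm41_koiranStep) : Burgisser2009_thm41_2_uniform := by
  intro hτ q b hb
  obtain ⟨hq, ⟨c, hc⟩, ⟨S, hS, hS'⟩, ⟨B, hB, hB'⟩⟩ := hb
  have hCHP : CH ⊆ PPoly := h25 (h212 hτ)
  -- the bit bound `p(n) = n^c + n ≥ n`
  have hp : IsPBounded (fun n => n ^ c + n) :=
    IsPBounded.add_holds (IsPBounded.pow_holds IsPBounded.id c) IsPBounded.id
  have hpn : ∀ n, n ≤ n ^ c + n := fun n => Nat.le_add_left _ _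
  -- the bit arrays of `b⁺` and `b⁻` and their `CH` languages
  have hLp : B ⊓ {x | (boolUnpair x).1 ∈ S} ∈ CH := inter_mem_CH hB (CH_closed_fst S hS)
  have hLm : B ⊓ {x | (boolUnpair x).1 ∈ Sᶜ} ∈ CH :=
    inter_mem_CH hB (CH_closed_fst Sᶜ (compl_mem_CH hS))
  have hfst : ∀ n k j, (boolUnpair (encBitQuery n k j true)).1 = encIdx n k := fun n k j => by
    simp [encBitQuery]
  have hagp : ∀ n k j, k ≤ q n → (encBitQuery n k j true ∈ B ⊓ {x | (boolUnpair x).1 ∈ S} ↔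
      (decide (0 ≤ b n k) && (b n k).natAbs.testBit j) = true) := by
    intro n k j hk
    change encBitQuery n k j true ∈ B ∧ (boolUnpair (encBitQuery n k j true)).1 ∈ S ↔ _
    rw [hB' n k j true hk, hfst, hS' n k hk, Bool.and_eq_true, decide_eq_true_iff, and_comm]
  have hagm : ∀ n k j, k ≤ q n → (encBitQuery n k j true ∈ B ⊓ {x | (boolUnpair x).1 ∈ Sᶜ} ↔
      (decide (b n k < 0) && (b n k).natAbs.testBit j) = true) := by
    intro n k j hk
    change encBitQuery n k j true ∈ B ∧ (boolUnpair (encBitQuery n k j true)).1 ∈ Sᶜ ↔ _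
    rw [hB' n k j true hk, hfst]
    change _ ∧ encIdx n k ∉ S ↔ _
    rw [hS' n k hk, Bool.and_eq_true, decide_eq_true_iff, and_comm, not_le]
  obtain ⟨sp, hsp, cp, hcp⟩ := thm41_2_signPart hτ h210 hK hCHP hp hq hpn _ hLp hagp
  obtain ⟨sm, hsm, cm, hcm⟩ := thm41_2_signPart hτ h210 hK hCHP hp hq hpn _ hLm hagm
  -- the exponent `e(n) = s⁺(r(n)) + s⁻(r(n))`
  have hrB := isPBounded_pair_bitLen hp hq
  refine ⟨fun n => sp (Nat.pair (bitLen (n ^ c + n)) (bitLen (q n))) +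
      sm (Nat.pair (bitLen (n ^ c + n)) (bitLen (q n))),
    IsPBounded.add_holds (IsPBounded.comp_holds hsp hrB) (IsPBounded.comp_holds hsm hrB), ?_⟩
  -- the bound for `n ≥ 2`
  have key : ∀ n, 2 ≤ n →
      tauPoly (Polynomial.C ((2 : ℤ) ^ (sp (Nat.pair (bitLen (n ^ c + n)) (bitLen (q n))) +
          sm (Nat.pair (bitLen (n ^ c + n)) (bitLen (q n))))) *
        ∑ k ∈ Finset.range (q n + 1), Polynomial.C (b n k) * Polynomial.X ^ k) ≤
      (3 * (sm (Nat.pair (bitLen (n ^ c + n)) (bitLen (q n))) + 1) + (Nat.log 2 n + 2) ^ cp + 1) +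
        (3 * (sp (Nat.pair (bitLen (n ^ c + n)) (bitLen (q n))) + 1) + (Nat.log 2 n + 2) ^ cm + 1) + 2 := by
    intro n hn
    rw [tauPoly_C_mul_sum]
    set r := Nat.pair (bitLen (n ^ c + n)) (bitLen (q n)) with hr
    set Fp : MvPolynomial (Fin 1) ℤ := ∑ k ∈ Finset.range (q n + 1),
      (∑ j ∈ Finset.range (n ^ c + n + 1),
        if (decide (0 ≤ b n k) && (b n k).natAbs.testBit j) then
          (C (2 : ℤ) : MvPolynomial (Fin 1) ℤ) ^ j else 0) * X 0 ^ k with hFp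
    set Fm : MvPolynomial (Fin 1) ℤ := ∑ k ∈ Finset.range (q n + 1),
      (∑ j ∈ Finset.range (n ^ c + n + 1),
        if (decide (b n k < 0) && (b n k).natAbs.testBit j) then
          (C (2 : ℤ) : MvPolynomial (Fin 1) ℤ) ^ j else 0) * X 0 ^ k with hFm
    -- `f_n = f⁺_n - f⁻_n`
    have hbits : ∀ k ∈ Finset.range (q n + 1), (b n k).natAbs < 2 ^ (n ^ c + n + 1) := by
      intro k hk
      have hk' : k ≤ q n := Nat.lt_succ_iff.1 (Finset.mem_range.1 hk)
      have h1 : |b n k| ≤ 2 ^ (n ^ c) := hc n k hn hk'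
      have h2 : ((b n k).natAbs : ℤ) ≤ 2 ^ (n ^ c) := by rwa [Int.natCast_natAbs]
      have h3 : (b n k).natAbs ≤ 2 ^ (n ^ c) := by exact_mod_cast h2
      exact lt_of_le_of_lt h3 (Nat.pow_lt_pow_right (by norm_num) (by omega))
    have hdec : (∑ k ∈ Finset.range (q n + 1), C (b n k) * (X 0 : MvPolynomial (Fin 1) ℤ) ^ k) =
        Fp - Fm := by
      rw [hFp, hFm, ← Finset.sum_sub_distrib]
      refine Finset.sum_congr rfl fun k hk => ?_
      rw [← sub_mul, sum_bits_posPart (hbits k hk), sum_bits_negPart (hbits k hk), ← map_sub]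
      congr 2
      by_cases h0 : 0 ≤ b n k
      · rw [if_pos h0, if_neg (not_lt.2 h0), sub_zero]
      · rw [if_neg h0, if_pos (not_le.1 h0), zero_sub, neg_neg]
    have hsplit : C ((2 : ℤ) ^ (sp r + sm r)) * (Fp - Fm) =
        C ((2 : ℤ) ^ sm r) * (C ((2 : ℤ) ^ sp r) * Fp) - C ((2 : ℤ) ^ sp r) * (C ((2 : ℤ) ^ sm r) * Fm) := by
      rw [pow_add, C_mul]
      ring
    rw [hdec, hsplit]
    have hp' := hcp n
    have hm' := hcm n
    rw [← hFp] at hp'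
    rw [← hFm] at hm'
    calc constantFreeComplexity (C ((2 : ℤ) ^ sm r) * (C ((2 : ℤ) ^ sp r) * Fp) -
          C ((2 : ℤ) ^ sp r) * (C ((2 : ℤ) ^ sm r) * Fm))
        ≤ constantFreeComplexity (C ((2 : ℤ) ^ sm r) * (C ((2 : ℤ) ^ sp r) * Fp)) +
            constantFreeComplexity (C ((2 : ℤ) ^ sp r) * (C ((2 : ℤ) ^ sm r) * Fm)) + 2 :=
          constantFreeComplexity_sub_le _ _
      _ ≤ (constantFreeComplexity (C ((2 : ℤ) ^ sm r) : MvPolynomial (Fin 1) ℤ) +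
            constantFreeComplexity (C ((2 : ℤ) ^ sp r) * Fp) + 1) +
          (constantFreeComplexity (C ((2 : ℤ) ^ sp r) : MvPolynomial (Fin 1) ℤ) +
            constantFreeComplexity (C ((2 : ℤ) ^ sm r) * Fm) + 1) + 2 := by
          gcongr <;> exact constantFreeComplexity_C_mul_le _ _
      _ ≤ (3 * (sm r + 1) + (Nat.log 2 n + 2) ^ cp + 1) +
          (3 * (sp r + 1) + (Nat.log 2 n + 2) ^ cm + 1) + 2 := by
          gcongr
          · exact constantFreeComplexity_C_two_pow_le' _
          · exact constantFreeComplexity_C_two_pow_le' _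
  -- the right-hand side is polylog
  have hr := polylog_pair_bitLen hp hq
  obtain ⟨c₁, hc₁⟩ : ∃ c₁ : ℕ, ∀ n,
      (3 * (sm (Nat.pair (bitLen (n ^ c + n)) (bitLen (q n))) + 1) + (Nat.log 2 n + 2) ^ cp + 1) +
        (3 * (sp (Nat.pair (bitLen (n ^ c + n)) (bitLen (q n))) + 1) + (Nat.log 2 n + 2) ^ cm + 1) + 2 ≤
      (Nat.log 2 n + 2) ^ c₁ :=
    polylog_add (polylog_add
      (polylog_add (polylog_add (polylog_mul (polylog_const 3) (polylog_add (polylog_comp hsm hr)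
        (polylog_const 1))) ⟨cp, fun _ => le_rfl⟩) (polylog_const 1))
      (polylog_add (polylog_add (polylog_mul (polylog_const 3) (polylog_add (polylog_comp hsp hr)
        (polylog_const 1))) ⟨cm, fun _ => le_rfl⟩) (polylog_const 1)))
      (polylog_const 2)
  exact polylog_of_two_le fun n hn => (key n hn).trans (hc₁ n)

/-- **Bürgisser's Theorem 1.1(2) from five cited facts**: Cor. 3.9 (coefficient form), Lemma 2.12,
Lemma 2.5(2), Thm. 2.10 and the application of Thm. 2.11 — the assembly of the whole paper
(ECCC TR06-113, proof of Thm. 1.1(2), p. 15, with Thm. 4.1(2) proved above). [cite: Burgisser2006, proof of Thm. 1.1(2)] -/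
theorem not_isPBounded_constantFreeComplexity_perPoly_of_tauConjecture_of_steps
    (h₁ : Burgisser2009_pochhammerWilkinson_coeff_chDefinable)
    (h212 : PP_subset_PPoly_of_isPBounded_perPoly) (h25 : CH_subset_PPoly_of_PP_subset_PPoly)
    (h210 : Burgisser2009_thm210) (hK : Burgisser2009_thm41_koiranStep) :
    not_isPBounded_constantFreeComplexity_perPoly_of_tauConjecture :=
  not_isPBounded_constantFreeComplexity_perPoly_of_tauConjecture_of h₁
    (Burgisser2009_thm41_2_uniform_of_steps h212 h25 h210 hK)

/-- **Bürgisser's Theorem 1.1(2) from the five cited theorems of the paper it rests on**: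
Cor. 3.9 (`σ_k(1,…,n)` definable in `CH`), Lemma 2.12, Lemma 2.5(2), Thm. 2.10 and the application
of Thm. 2.11 — everything else (Def. 3.1 bookkeeping, the reindexing of the coefficients, Thm. 4.1(2)
with its sign gap, the growth argument of p. 15) is proved in the tree (ECCC TR06-113, proof of
Thm. 1.1(2), p. 15). [cite: Burgisser2006, Thm. 1.1(2)] -/
theorem not_isPBounded_constantFreeComplexity_perPoly_of_tauConjecture_of_facts
    (h39 : Burgisser2009_esymm_chDefinable)
    (h212 : PP_subset_PPoly_of_isPBounded_perPoly) (h25 : CH_subset_PPoly_of_PP_subset_PPoly)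
    (h210 : Burgisser2009_thm210) (hK : Burgisser2009_thm41_koiranStep) :
    not_isPBounded_constantFreeComplexity_perPoly_of_tauConjecture :=
  not_isPBounded_constantFreeComplexity_perPoly_of_tauConjecture_of_steps
    (Burgisser2009_pochhammerWilkinson_coeff_chDefinable_of_esymm h39) h212 h25 h210 hK

end Literature.Computability.AlgebraicComplexity
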